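import Literature.NumberTheory.Transcendental.BakerQuantSetup
import HarnessLib

/-!
# Baker 1975, Ch. 3 — the parameters of the proof of Theorem 3.1

Support for the proof of Theorem 3.1 of A. Baker, *Transcendental Number Theory* (1975), Ch. 3
(`Literature.NumberTheory.Transcendental.baker1975_thm_3_1`). Baker (p. 32) takes "an integer `k`
exceeding a sufficiently large number `c`", `h = [log(kB)]`, `L₋₁ = h - 1`,
`L = L₀ = ⋯ = Lₙ = [k^{1-1/(4n)}]`, and in Lemma 6 the ranges `R_J = [h k^{εJ}]` and orders
`S_J = [k/2^J]`, `0 ≤ J ≤ 8n/ε`, with circles of radius `R_{K+1} k^{1/(8n)}`; Lemma 7 uses the points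
`l/k`. As in the tree's proof of the qualitative theorem (`BakerLogarithmsConclusion.lean`) we
replace the fractional powers by pure powers of one large integer `s` (the base), so that every
quantity is a natural number:

* `gp = 1000 (D₀+1)² (n+2)²` — the exponent of the circle factor `s^{gp}` (Baker's `k^{1/(8n)}`);
* `eL = (gp+2)(n+1) + 2`, `L = s^{eL}`; `ek = eL + gp + 2`, `k = 2^{J₁} s^{ek}` (the maximal order);
  `Sord J = 2^{J₁-J} s^{ek}` (the orders at stage `J`, halving as in the source); the ranges are
  `h s^{J+1}` (`J = 0` being the Siegel range), the circle for the step `J → J+1` has radius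
  `h s^{J+2+gp}`; `J₁ = eL(2n+3) + n + 3` steps; the points of Lemma 7 are `l/q`, `q = s^{eL+1} = L s`.

This file records the elementary arithmetic of these parameters (everything proved):
`Sord_zero`, `Sord_succ_add` (halving), the Siegel count `siegel_count`
(`2 · (h s) (k+1)^{n+1} D₀^{2n+2} ≤ h (L+1)^{n+2}` for `s ≥ sSieg`), and `Lp_mul_lt_qp`
(`L Λ < q` for `s > Λ`).

## References

* A. Baker, *Transcendental Number Theory*, Cambridge Univ. Press 1975, Ch. 3 §3 (p. 32, p. 35)
  and §4. [BakerTNT1975]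
* The tree's `Literature/NumberTheory/Transcendental/BakerLogarithmsConclusion.lean` (the same
  device of pure powers for Ch. 2).
-/

noncomputable section

open Finset

namespace Literature.NumberTheory.Transcendental.Baker1975.Ch3

namespace Setup

variable (S : Setup)

/-- The exponent `gp = 1000 (D₀+1)² (n+2)²` of the circle factor `s^{gp}` (generous, so that the
step inequality of Lemma 6 holds with room at `J = 0`). [cite: BakerTNT1975, Ch. 3 §3 Lemma 6] -/
def gp : ℕ := 1000 * (S.D₀ + 1) ^ 2 * (S.n + 2) ^ 2

/-- The exponent of `L`: `eL = (gp+2)(n+1) + 2`. [cite: BakerTNT1975, Ch. 3 §3] -/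
def eL : ℕ := (S.gp + 2) * (S.n + 1) + 2

/-- The number of extrapolation steps `J₁ = eL(2n+3) + n + 3`. [cite: BakerTNT1975, Ch. 3 §3 Lemma 6] -/
def J₁ : ℕ := S.eL * (2 * S.n + 3) + S.n + 3

/-- The exponent of the maximal order: `ek = eL + gp + 2`. [cite: BakerTNT1975, Ch. 3 §3] -/
def ek : ℕ := S.eL + S.gp + 2

/-- `L = s^{eL}` (Baker's `L = [k^{1-1/(4n)}]`). [cite: BakerTNT1975, Ch. 3 §3] -/
def Lp (s : ℕ) : ℕ := s ^ S.eL

/-- `k = 2^{J₁} s^{ek}`, the maximal order of derivatives (Baker's `k`). [cite: BakerTNT1975, Ch. 3 §3] -/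
def kp (s : ℕ) : ℕ := 2 ^ S.J₁ * s ^ S.ek

/-- The orders at stage `J`: `Sord J = 2^{J₁ - J} s^{ek}` (Baker's `S_J = [k/2^J]`). [cite: BakerTNT1975, Ch. 3 §3 Lemma 6] -/
def Sord (s J : ℕ) : ℕ := 2 ^ (S.J₁ - J) * s ^ S.ek

/-- The denominator of the points of Lemma 7: `q = s^{eL+1} = L s` (Baker's `k` in `l/k`).
[cite: BakerTNT1975, Ch. 3 §3 Lemma 7] -/
def qp (s : ℕ) : ℕ := s ^ (S.eL + 1)

/-! ### Elementary facts -/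

/-- `1 ≤ gp`. [folklore] -/
theorem one_le_gp : 1 ≤ S.gp := by
  unfold gp
  have h1 : 1 ≤ (S.D₀ + 1) ^ 2 := Nat.one_le_pow _ _ (Nat.succ_pos _)
  have h2 : 1 ≤ (S.n + 2) ^ 2 := Nat.one_le_pow _ _ (by omega)
  calc 1 ≤ 1000 * 1 * 1 := by norm_num
    _ ≤ 1000 * (S.D₀ + 1) ^ 2 * (S.n + 2) ^ 2 := Nat.mul_le_mul (Nat.mul_le_mul_left _ h1) h2

/-- `3 ≤ eL`. [folklore] -/
theorem three_le_eL : 3 ≤ S.eL := by unfold eL; nlinarith [S.one_le_gp]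

/-- `Sord s 0 = k`. [folklore] -/
theorem Sord_zero (s : ℕ) : S.Sord s 0 = S.kp s := by simp [Sord, kp]

/-- **Halving**: `Sord (J+1) + Sord (J+1) = Sord J` for `J < J₁`. [cite: BakerTNT1975, Ch. 3 §3 Lemma 6] -/
theorem Sord_succ_add {s J : ℕ} (hJ : J < S.J₁) : S.Sord s (J + 1) + S.Sord s (J + 1) = S.Sord s J := by
  unfold Sord
  rw [← two_mul, ← mul_assoc, ← pow_succ']
  congr 2; omega

/-- `Sord J ≤ k`. [folklore] -/
theorem Sord_le_kp (s J : ℕ) : S.Sord s J ≤ S.kp s := by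
  unfold Sord kp
  exact Nat.mul_le_mul_right _ (Nat.pow_le_pow_right (by norm_num) (Nat.sub_le _ _))

/-- `s^{ek} ≤ Sord J`. [folklore] -/
theorem pow_ek_le_Sord (s J : ℕ) : s ^ S.ek ≤ S.Sord s J := by
  unfold Sord; exact Nat.le_mul_of_pos_left _ (pow_pos (by norm_num) _)

/-- `Sord J₁ = s^{ek}`. [folklore] -/
theorem Sord_J₁ (s : ℕ) : S.Sord s S.J₁ = s ^ S.ek := by simp [Sord]

/-- `k = 2^{J₁} L s^{gp+2}`. [folklore] -/
theorem kp_eq (s : ℕ) : S.kp s = 2 ^ S.J₁ * (S.Lp s * s ^ (S.gp + 2)) := by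
  unfold kp Lp ek; rw [← pow_add, add_assoc]

/-- `Sord (J+1) = 2^{J₁ - J - 1} L s^{gp+2}` and in particular `L s^{gp+2} ≤ Sord (J+1)` for `J < J₁`. [folklore] -/
theorem Lp_mul_le_Sord (s J : ℕ) : S.Lp s * s ^ (S.gp + 2) ≤ S.Sord s J := by
  have : S.Lp s * s ^ (S.gp + 2) = s ^ S.ek := by unfold Lp ek; rw [← pow_add, add_assoc]
  rw [this]; exact S.pow_ek_le_Sord s J

/-- `q = L s`. [folklore] -/
theorem qp_eq (s : ℕ) : S.qp s = S.Lp s * s := by unfold qp Lp; rw [pow_succ]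

/-- `1 ≤ L` for `1 ≤ s`. [folklore] -/
theorem one_le_Lp {s : ℕ} (hs : 1 ≤ s) : 1 ≤ S.Lp s := Nat.one_le_pow _ _ hs

/-- `1 ≤ k` for `1 ≤ s`. [folklore] -/
theorem one_le_kp {s : ℕ} (hs : 1 ≤ s) : 1 ≤ S.kp s :=
  Nat.mul_pos (pow_pos (by norm_num) _) (pow_pos hs _)

/-- `0 < q` for `1 ≤ s`. [folklore] -/
theorem qp_pos {s : ℕ} (hs : 1 ≤ s) : 0 < S.qp s := pow_pos hs _

/-- The identity `ek (n+1) + 2 = eL (n+2)` behind the Siegel count. [folklore] -/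
theorem ek_mul : S.ek * (S.n + 1) + 2 = S.eL * (S.n + 2) := by
  unfold ek eL; ring

/-! ### The Siegel count -/

/-- The threshold `sSieg = 2^{n+2+J₁(n+1)} (D₀+1)^{2n+2}` for the Siegel count. [folklore] -/
def sSieg : ℕ := 2 ^ (S.n + 2 + S.J₁ * (S.n + 1)) * (S.D₀ + 1) ^ (2 * S.n + 2)

/-- **The Siegel count** (Baker, p. 33: "`N > h k^{n+1/2} > 2M`"): for `s ≥ sSieg`,
`2 · ((h s) (k+1)^{n+1} D₀^{2n+2}) ≤ h (L+1) (L+1)^{n+1} = #Idx`. [cite: BakerTNT1975, Ch. 3 §3 Lemma 4] -/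
theorem siegel_count {s : ℕ} (hs : S.sSieg ≤ s) (h : ℕ) :
    2 * (h * s * (S.kp s + 1) ^ (S.n + 1) * S.D₀ ^ (2 * S.n + 2)) ≤ h * (S.Lp s + 1) * (S.Lp s + 1) ^ (S.n + 1) := by
  have hs1 : 1 ≤ s := le_trans (Nat.one_le_iff_ne_zero.mpr (by unfold sSieg; positivity)) hs
  -- `k + 1 ≤ 2 k`
  have hk1 : S.kp s + 1 ≤ 2 * S.kp s := by have := S.one_le_kp hs1; omega
  -- `(k+1)^{n+1} ≤ 2^{n+1} 2^{J₁(n+1)} s^{ek(n+1)}`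
  have hk2 : (S.kp s + 1) ^ (S.n + 1) ≤ 2 ^ (S.n + 1) * 2 ^ (S.J₁ * (S.n + 1)) * s ^ (S.ek * (S.n + 1)) := by
    calc (S.kp s + 1) ^ (S.n + 1) ≤ (2 * S.kp s) ^ (S.n + 1) := Nat.pow_le_pow_left hk1 _
      _ = 2 ^ (S.n + 1) * 2 ^ (S.J₁ * (S.n + 1)) * s ^ (S.ek * (S.n + 1)) := by
          unfold kp; rw [mul_pow, mul_pow, ← pow_mul, ← pow_mul]; ring
  have hD : S.D₀ ^ (2 * S.n + 2) ≤ (S.D₀ + 1) ^ (2 * S.n + 2) := Nat.pow_le_pow_left (Nat.le_succ _) _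
  -- the left side is at most `sSieg · h · s^{ek(n+1) + 1}`
  have hl : 2 * (h * s * (S.kp s + 1) ^ (S.n + 1) * S.D₀ ^ (2 * S.n + 2)) ≤
      h * (S.sSieg * s ^ (S.ek * (S.n + 1) + 1)) := by
    calc 2 * (h * s * (S.kp s + 1) ^ (S.n + 1) * S.D₀ ^ (2 * S.n + 2))
        ≤ 2 * (h * s * (2 ^ (S.n + 1) * 2 ^ (S.J₁ * (S.n + 1)) * s ^ (S.ek * (S.n + 1))) *
            (S.D₀ + 1) ^ (2 * S.n + 2)) := by gcongr
      _ = h * (S.sSieg * s ^ (S.ek * (S.n + 1) + 1)) := by unfold sSieg; ring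
  refine hl.trans ?_
  rw [mul_assoc]
  refine Nat.mul_le_mul_left _ ?_
  -- `sSieg · s^{ek(n+1)+1} ≤ s^{ek(n+1)+2} = s^{eL(n+2)} ≤ (L+1)^{n+2}`
  calc S.sSieg * s ^ (S.ek * (S.n + 1) + 1) ≤ s * s ^ (S.ek * (S.n + 1) + 1) := Nat.mul_le_mul_right _ hs
    _ = s ^ (S.eL * (S.n + 2)) := by rw [← pow_succ', S.ek_mul.symm]
    _ = S.Lp s * S.Lp s ^ (S.n + 1) := by unfold Lp; rw [← pow_succ', ← pow_mul]
    _ ≤ (S.Lp s + 1) * (S.Lp s + 1) ^ (S.n + 1) :=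
        Nat.mul_le_mul (Nat.le_succ _) (Nat.pow_le_pow_left (Nat.le_succ _) _)

/-! ### `L Λ < q` -/

/-- **`L Λ < q`** as soon as `s > Λ` (so that the relation `∑ bᵢ lᵢ = 2πi j q`, `|bᵢ| ≤ L`, forces
`j = 0`, Baker, p. 37: "the number on the left has absolute value less than `2πk`").
[cite: BakerTNT1975, Ch. 3 §4] -/
theorem Lp_mul_lt_qp {s : ℕ} (hs : S.Λ < s) : (S.Lp s : ℝ) * S.Λ < S.qp s := by
  rw [S.qp_eq]
  push_cast
  have hL : (0 : ℝ) < S.Lp s := by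
    have : 1 ≤ S.Lp s := S.one_le_Lp (by
      have h1 := S.one_le_Λ
      have : (1 : ℝ) ≤ s := by linarith
      exact_mod_cast this)
    exact_mod_cast this
  exact mul_lt_mul_of_pos_left hs hL

end Setup

end Literature.NumberTheory.Transcendental.Baker1975.Ch3
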